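import Summits.QuantumFields.BalabanUV.T4Continuum.Support.NE3BlockPoincareTangent
import HarnessLib

/-!
# T⁴ programme, node NE3, row E-MLw-(w4)-P · Φ2 — (P_1) ON THE FLAT FRAME-FREE SLICE, N-FREE, NO LANDAU:
# `TangentIter L j 1 Y ∧ framePot L (j+1) Y = 0 ⇒ (Qcoarse L)^[j+1] Y = 0 ⇒ Σ‖Y‖² ≤ 5·(L^{j+1})²·Σ‖∂Y‖²`

NE3 formalisation swarm `b2b-balaban-t4-ne3-formalise-*`, LEAF PROVER 04 (gen 4), row **Φ2** of the owner's re-cut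
(`t4-ne3-p1-g21`, RULING ρ-g21-3 ∕ `HOME/t4/b2b-balaban-t4-ne3-p1/g21/D-ne3p1-g21-2.md` (V6) + §2: «(P_1) on the flat slice: `Σ‖Y‖² ≤ 5(L^k)²·gradSq`
(leaf-04 `sum_norm_sq_le_of_iterate_Qcoarse_eq_zero` ∕ `sum_norm_sq_le_stable` + Φ1) in the matrix ∕ `dirSq` currencies; N-free, no Landau»;
INTENT HOME/CLAIMS.log 2026-08-20 ≈15:29Z).  On the FRAME-FREE SLICE `T_♮(1) ⊂ ker d(avgIter k)(1) ∩ {framePot = 0}` the tangency reading of this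
unit's file (A) (`NE3TangentFlatStructure.iterate_Qcoarse_eq_dPot_of_tangentIter`: `(Qcoarse L)^[k] Y = dPot (framePot L k Y)`) says the straight
k-block average VANISHES, and this unit's N-free block-Poincaré twins (`NE3BlockPoincareTangent.…_of_iterate_Qcoarse_eq_zero`, p219822) apply
verbatim: constant `5`, N-free, k-free, holonomy-free (flat), NO Landau clause used.

CONTENT (all [folklore]; 0 sorry; 0 def; hypotheses stated explicitly — the block-constant-divergence clause of `T_♮` is NOT needed here; a
Set-membership wrapper against Φ1's `frameFreeBlockLandau` is a later 5-line append):
* `iterate_Qcoarse_eq_zero_of_frameFree` — `TangentIter L j 1 Y → framePot L (j+1) Y = 0 → (Qcoarse L)^[j+1] Y = 0`;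
* **`sum_nhsNormSq_le_of_frameFree`** — `Σ_x Σ_κ nhsNormSq (Y x κ) ≤ 5·(L^{j+1})²·Σ_x Σ_κ Σ_μ nhsNormSq (Y(x+e_μ) κ − Y x κ)` over `periodBox (N·L^{j+1})`;
* **`dirSq_le_of_frameFree`** — `dirSq Y (periodBox (N·L^{j+1})) ≤ card n·5·(L^{j+1})²·Σ_x Σ_κ Σ_μ ‖Y(x+e_μ) κ − Y x κ‖²`.

HONEST: flat-lattice kinematics on OUR frame; (P_W)∕(ML_w) at W = cavg L U_B, Φ3 = (μK)♮, T-E_w, NE3 NOT proved; spine 0∕9; finite T⁴ rung (B)+1 —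
NOT infinite volume, NOT mass gap, NOT BetaPertH, NOT Clay.  PLACEMENT: `Summits/QuantumFields/BalabanUV/`.
-/

set_option autoImplicit false

open scoped BigOperators Matrix.Norms.L2Operator
open Finset

namespace Summit.QuantumFields.BalabanUV.T4Continuum.NE3BlockPoincareFrameFree

open Literature.MathematicalPhysics.QuantumFieldTheory.Balaban1983to89
open B7Prop1Explicit
open T4AveragingDeficitWall (dirSq)
open T4AveragingDeficitWallBoundary (periodBox)
open AveragingDeficitPeriodicCounting (IsPeriodicDir)
open AveragingDeficitMultiLevelPrep (TangentIter)
open BlockAveragePushDirSplit (flat)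
open NE3TangentNoGoWords (dPot)
open NE3TangentFlatStructure (Qcoarse framePot iterate_Qcoarse_eq_dPot_of_tangentIter)
open MatrixNorms (nhsNormSq)
open NE3BlockPoincareTangent (sum_nhsNormSq_le_of_iterate_Qcoarse_eq_zero dirSq_le_of_iterate_Qcoarse_eq_zero)

noncomputable section

variable {d : ℕ} {n : Type*} [Fintype n] [DecidableEq n] [Nonempty n]

omit [Nonempty n] in
/-- **FRAME-FREE TANGENT DIRECTIONS HAVE VANISHING STRAIGHT k-BLOCK AVERAGE**: `TangentIter L j 1 Y`, `framePot L (j+1) Y = 0` ⇒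
`(Qcoarse L)^[j+1] Y = 0` ((A): `(Qcoarse L)^[j+1] Y = dPot (framePot L (j+1) Y)`). [folklore] -/
theorem iterate_Qcoarse_eq_zero_of_frameFree {L : ℕ} (hL : 1 ≤ L) {j : ℕ} {Y : Site d → Fin d → Matrix n n ℂ}
    (hT : TangentIter L j (flat (d := d) (n := n)) Y) (hF : framePot L (j + 1) Y = 0) : (Qcoarse L)^[j + 1] Y = 0 := by
  rw [iterate_Qcoarse_eq_dPot_of_tangentIter hL hT, hF]
  funext x μ
  simp [dPot]

/-- **(P_1) ON THE FLAT FRAME-FREE SLICE, Hilbert–Schmidt currency, N-FREE**: for `L ≥ 1`, `N ≥ 1`, an `(N·L^{j+1})`-periodic `Y` with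
`TangentIter L j 1 Y` and `framePot L (j+1) Y = 0`,
`Σ_x Σ_κ nhsNormSq (Y x κ) ≤ 5·(L^{j+1})²·Σ_x Σ_κ Σ_μ nhsNormSq (Y(x+e_μ) κ − Y x κ)` over `periodBox (N·L^{j+1})` — no Landau clause, no `N`,
no factor `card n`. [folklore] -/
theorem sum_nhsNormSq_le_of_frameFree {L : ℕ} (hL : 1 ≤ L) {N : ℕ} (hN : 1 ≤ N) {j : ℕ} {Y : Site d → Fin d → Matrix n n ℂ}
    (hYper : IsPeriodicDir Y ((N * L ^ (j + 1) : ℕ) : ℤ)) (hT : TangentIter L j (flat (d := d) (n := n)) Y)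
    (hF : framePot L (j + 1) Y = 0) :
    ∑ x ∈ periodBox (d := d) (N * L ^ (j + 1)), ∑ κ : Fin d, nhsNormSq (Y x κ)
      ≤ 5 * ((L : ℝ) ^ (j + 1)) ^ 2
          * ∑ x ∈ periodBox (d := d) (N * L ^ (j + 1)), ∑ κ : Fin d, ∑ μ : Fin d, nhsNormSq (Y (x + e μ) κ - Y x κ) :=
  sum_nhsNormSq_le_of_iterate_Qcoarse_eq_zero hL hN hYper (iterate_Qcoarse_eq_zero_of_frameFree hL hT hF)

/-- **(P_1) ON THE FLAT FRAME-FREE SLICE, operator-norm currency**: `dirSq Y (periodBox (N·L^{j+1})) ≤ card n·5·(L^{j+1})²·Σ_x Σ_κ Σ_μ ‖Y(x+e_μ) κ − Y x κ‖²`.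
[folklore] -/
theorem dirSq_le_of_frameFree {L : ℕ} (hL : 1 ≤ L) {N : ℕ} (hN : 1 ≤ N) {j : ℕ} {Y : Site d → Fin d → Matrix n n ℂ}
    (hYper : IsPeriodicDir Y ((N * L ^ (j + 1) : ℕ) : ℤ)) (hT : TangentIter L j (flat (d := d) (n := n)) Y)
    (hF : framePot L (j + 1) Y = 0) :
    dirSq Y (periodBox (d := d) (N * L ^ (j + 1)))
      ≤ Fintype.card n * 5 * ((L : ℝ) ^ (j + 1)) ^ 2
          * ∑ x ∈ periodBox (d := d) (N * L ^ (j + 1)), ∑ κ : Fin d, ∑ μ : Fin d, ‖Y (x + e μ) κ - Y x κ‖ ^ 2 :=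
  dirSq_le_of_iterate_Qcoarse_eq_zero hL hN hYper (iterate_Qcoarse_eq_zero_of_frameFree hL hT hF)

end

end Summit.QuantumFields.BalabanUV.T4Continuum.NE3BlockPoincareFrameFree
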